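import Literature.Computability.Complexity.ExtMonotoneGates
import Literature.Computability.Complexity.CircuitComposition
import Mathlib.Combinatorics.Hall.Basic
import Mathlib.Logic.Equiv.Fin.Basic
import Mathlib.Algebra.Order.Star.Real
import HarnessLib

/-!
# Crux `Capture` (stmt-PneNP-2659) — duality audit, cell D1: the DUAL of bipartite perfect matching is
# ONE CONV gate (König / Hall weak duality)

The extended basis of route `PneNP/ConvexRankGates` contains bipartite perfect matching as ONE GRANK gate
(`BpmIsOneRankGate`, Edmonds matrix) and as one LP gate (Oliveira–Pudlák 2019, Thm 5.2). The crux
`Capture` predicts that the Boolean DUAL `f^d(x) = ¬ f(¬ x)` of every tame door is again a polynomial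
extended circuit (a monotone `f` with a polynomial `B₂`-circuit has a dual with a polynomial
`B₂`-circuit). For bipartite perfect matching the dual door is the BLOCKER function

  `v ↦ [every perfect matching of K_{n,n} meets the selected edge set v]`
  `= [K_{n,n} − v has no perfect matching]`,

and this file proves it is ONE CONV gate of width `n² + 2n + 1` (`dualBpm_isConvGate`): the LP with one
diagonal variable `z_u ≥ 0` per vertex `u` of `K_{n,n}`, the `n²` constraints
`-z_i - z_{n+j} ≤ -1 + [v (i,j)]` (a fractional vertex cover of the SURVIVING edges; the selected edges
relax their constraint — right-hand sides with non-negative input coefficients, as the gate class demands)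
and the budget constraint `∑_u z_u ≤ n - 1`.

* If `K_{n,n} − v` has no perfect matching, Hall's condition fails (Mathlib's
  `Fintype.all_card_le_filter_rel_iff_exists_injective`): some `A ⊆ Fin n` has `|N(A)| < |A|`, and the
  vertex cover `(Fin n ∖ A) ∪ N(A)` of the surviving edges has `≤ n - 1` vertices — an integral feasible
  point.
* If `z` is feasible and `σ` were a perfect matching avoiding `v`, summing the `n` constraints of the edges
  `(i, σ i)` gives `∑_u z_u ≥ n`, contradicting the budget (weak duality; no total unimodularity needed).

Hence the duality audit PASSES on the transversal (bipartite-matching) slice of GRANK. [folklore; König 1931,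
Hall 1935 via Mathlib]
-/

namespace Summit.PneNP.PneNP.Theorems.Capture.DualityAudit

set_option linter.dupNamespace false -- `Summit.PneNP.PneNP.…`: summit = sub-problem (D-0017)

open Literature.Computability.Complexity Finset Matrix

noncomputable section

variable (n : ℕ)

/-- The width of the LP: `n² + 1` constraints and `2n` (diagonal) variables. [folklore] -/
theorem dualBpm_width : Fintype.card (Option (Fin n × Fin n)) + (n + n) = n * n + 2 * n + 1 := by
  simp [Fintype.card_option, Fintype.card_prod, Fintype.card_fin]; ring

/-- **The dual of bipartite perfect matching is ONE CONV gate** of width `n² + 2n + 1`. The gate has arity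
`n * n` (edge `(i,j)` is wire `finProdFinEquiv (i,j)`) and accepts the selection `v` iff EVERY perfect
matching `i ↦ (i, σ i)` of `K_{n,n}` meets a selected edge, i.e. iff `K_{n,n}` minus the selected edges has
no perfect matching; this blocker function is LP feasibility of a fractional vertex cover of the surviving
edges with total weight `≤ n - 1` (König/Hall one way, weak duality the other). [folklore] -/
theorem dualBpm_isConvGate : IsConvGate (n * n + 2 * n + 1)
    ⟨n * n, fun v => decide (∀ σ : Equiv.Perm (Fin n), ∃ i, v (finProdFinEquiv (i, σ i)) = true)⟩ := by
  dsimp only [IsConvGate]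
  -- indexing: constraints by `Option (Fin n × Fin n)`, variables by `Fin n ⊕ Fin n`
  let eP := Fintype.equivFin (Option (Fin n × Fin n))
  let L : Fin n → Fin (n + n) := fun i => finSumFinEquiv (Sum.inl i)
  let R : Fin n → Fin (n + n) := fun j => finSumFinEquiv (Sum.inr j)
  let A : Fin (Fintype.card (Option (Fin n × Fin n))) → Matrix (Fin (n + n)) (Fin (n + n)) ℝ :=
    fun c => (eP.symm c).elim 1 fun ij => -(Matrix.single (L ij.1) (L ij.1) 1 +
      Matrix.single (R ij.2) (R ij.2) 1)
  let b : Fin (Fintype.card (Option (Fin n × Fin n))) → ℝ :=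
    fun c => (eP.symm c).elim ((n : ℝ) - 1) fun _ => -1
  let B : Fin (Fintype.card (Option (Fin n × Fin n))) → Fin (n * n) → ℝ :=
    fun c j' => (eP.symm c).elim 0 fun ij => if j' = finProdFinEquiv ij then 1 else 0
  refine ⟨Fintype.card (Option (Fin n × Fin n)), n + n, (dualBpm_width n).le, A, b, B, ?_, ?_⟩
  · -- `B ≥ 0`
    intro c j'
    simp only [B]
    cases eP.symm c with
    | none => simp
    | some ij =>
      simp only [Option.elim_some]
      split_ifs <;> norm_num
  · intro v
    rw [decide_eq_true_iff]
    -- bookkeeping identities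
    have hsum : ∀ j : Fin (n * n),
        (∑ j', (if j' = j then (1 : ℝ) else 0) * (if v j' then (1 : ℝ) else 0)) =
          if v j then 1 else 0 := fun j => by
      rw [Finset.sum_eq_single j (fun j' _ hne => by rw [if_neg hne, zero_mul])
        (fun h => absurd (Finset.mem_univ j) h), if_pos rfl, one_mul]
    have htrace : ∀ Y : Matrix (Fin (n + n)) (Fin (n + n)) ℝ,
        Y.trace = ∑ i, Y (L i) (L i) + ∑ j, Y (R j) (R j) := fun Y => by
      rw [Matrix.trace, ← Fintype.sum_equiv finSumFinEquiv (fun w => Y (finSumFinEquiv w)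
        (finSumFinEquiv w)) (fun k => Matrix.diag Y k) (fun w => rfl), Fintype.sum_sum_type]
    -- the semantics of the `n² + 1` constraints for a given `Y`
    have hA0 : ∀ Y : Matrix (Fin (n + n)) (Fin (n + n)) ℝ, (A (eP none) * Y).trace = Y.trace := fun Y => by
      simp only [A, Equiv.symm_apply_apply, Option.elim_none, Matrix.one_mul]
    have hb0 : b (eP none) + ∑ j, B (eP none) j * (if v j then (1 : ℝ) else 0) = (n : ℝ) - 1 := by
      simp only [b, B, Equiv.symm_apply_apply, Option.elim_none, zero_mul, Finset.sum_const_zero, add_zero]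
    have hA1 : ∀ (Y : Matrix (Fin (n + n)) (Fin (n + n)) ℝ) (ij : Fin n × Fin n),
        (A (eP (some ij)) * Y).trace = -(Y (L ij.1) (L ij.1) + Y (R ij.2) (R ij.2)) := fun Y ij => by
      simp only [A, Equiv.symm_apply_apply, Option.elim_some]
      rw [Matrix.neg_mul, Matrix.trace_neg, Matrix.add_mul, Matrix.trace_add,
        Matrix.trace_single_mul, Matrix.trace_single_mul, smul_eq_mul, smul_eq_mul, one_mul, one_mul]
    have hb1 : ∀ ij : Fin n × Fin n, b (eP (some ij)) + ∑ j, B (eP (some ij)) j * (if v j then (1 : ℝ) else 0) =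
        -1 + (if v (finProdFinEquiv ij) then (1 : ℝ) else 0) := fun ij => by
      simp only [b, B, Equiv.symm_apply_apply, Option.elim_some]
      rw [hsum]
    constructor
    · -- no perfect matching avoids `v` ⟹ Hall fails ⟹ a small vertex cover ⟹ feasible diagonal `Y`
      intro hall
      -- the surviving-edge relation
      let r : Fin n → Fin n → Prop := fun i j => v (finProdFinEquiv (i, j)) = false
      have hnot := mt (Fintype.all_card_le_filter_rel_iff_exists_injective r).1 (by
        rintro ⟨f, hf, hfr⟩
        obtain ⟨i, hi⟩ := hall (Equiv.ofBijective f (Finite.injective_iff_bijective.1 hf))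
        have := hfr i
        simp only [r, Equiv.ofBijective_apply] at this hi
        rw [this] at hi
        exact Bool.false_ne_true hi)
      simp only [not_forall, not_le] at hnot
      obtain ⟨S, hS₀⟩ := hnot
      let N : Finset (Fin n) := univ.filter fun j => ∃ i ∈ S, r i j
      have hS : N.card < S.card := by
        refine lt_of_le_of_lt (Finset.card_le_card fun j hj => ?_) hS₀
        simp only [Finset.mem_filter, Finset.mem_univ, true_and, N] at hj ⊢
        exact hj
      -- the integral vertex cover `(Fin n ∖ S) ∪ N(S)`
      let d : Fin (n + n) → ℝ := fun k => Sum.elim (fun i => if i ∈ S then 0 else 1)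
        (fun j => if j ∈ N then 1 else 0) (finSumFinEquiv.symm k)
      have hdL : ∀ i, d (L i) = if i ∈ S then 0 else 1 := fun i => by
        simp only [d, L, Equiv.symm_apply_apply, Sum.elim_inl]
      have hdR : ∀ j, d (R j) = if j ∈ N then 1 else 0 := fun j => by
        simp only [d, R, Equiv.symm_apply_apply, Sum.elim_inr]
      have hd0 : 0 ≤ d := fun k => by
        simp only [d, Pi.zero_apply]
        cases finSumFinEquiv.symm k <;> simp only [Sum.elim_inl, Sum.elim_inr] <;> split_ifs <;> norm_num
      refine ⟨Matrix.diagonal d, Matrix.PosSemidef.diagonal hd0, fun c => ?_⟩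
      obtain ⟨o, rfl⟩ := eP.surjective c
      rcases o with _ | ⟨i, j⟩
      · -- budget: `(n - |S|) + |N(S)| ≤ n - 1`
        rw [hA0, hb0, htrace]
        simp only [Matrix.diagonal_apply_eq, hdL, hdR]
        rw [Finset.sum_ite, Finset.sum_const_zero, zero_add, Finset.sum_const, nsmul_eq_mul, mul_one,
          Finset.sum_ite, Finset.sum_const_zero, add_zero, Finset.sum_const, nsmul_eq_mul, mul_one]
        have h1 : ((univ.filter fun i : Fin n => i ∉ S).card : ℝ) = n - S.card := by
          have := Finset.card_filter_add_card_filter_not (s := (univ : Finset (Fin n)))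
            (fun i => i ∈ S)
          simp only [Finset.filter_mem_eq_inter, Finset.univ_inter, Finset.card_univ,
            Fintype.card_fin] at this
          have h' : ((univ.filter fun i : Fin n => i ∉ S).card : ℝ) + S.card = n := by
            exact_mod_cast (by omega : (univ.filter fun i : Fin n => i ∉ S).card + S.card = n)
          linarith
        have h2 : (univ.filter fun j : Fin n => j ∈ N) = N := by
          ext j; simp [N]
        rw [h1, h2]
        have h3 : (N.card : ℝ) + 1 ≤ S.card := by exact_mod_cast hS
        linarith
      · -- edge `(i,j)`: covered unless selected
        rw [hA1, hb1]
        simp only [Matrix.diagonal_apply_eq, hdL, hdR]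
        by_cases hv : v (finProdFinEquiv (i, j)) = true
        · rw [if_pos hv]
          have hi : (0 : ℝ) ≤ (if i ∈ S then (0 : ℝ) else 1) := by split_ifs <;> norm_num
          have hj : (0 : ℝ) ≤ (if j ∈ N then (1 : ℝ) else 0) := by split_ifs <;> norm_num
          linarith
        · rw [if_neg hv, add_zero]
          have hr : r i j := by simpa [r] using hv
          by_cases hiS : i ∈ S
          · have hjN : j ∈ N := by
              simp only [N, Finset.mem_filter, Finset.mem_univ, true_and]
              exact ⟨i, hiS, hr⟩
            rw [if_pos hiS, if_pos hjN]; norm_num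
          · rw [if_neg hiS]
            have hj : (0 : ℝ) ≤ (if j ∈ N then (1 : ℝ) else 0) := by split_ifs <;> norm_num
            linarith
    · -- a feasible `Y` and a perfect matching avoiding `v` contradict the budget (weak duality)
      rintro ⟨Y, -, hc⟩ σ
      by_contra hσ
      simp only [not_exists, Bool.not_eq_true] at hσ
      have hb : Y.trace ≤ (n : ℝ) - 1 := by
        have h := hc (eP none)
        rwa [hA0, hb0] at h
      have he : ∀ i, 1 ≤ Y (L i) (L i) + Y (R (σ i)) (R (σ i)) := fun i => by
        have h := hc (eP (some (i, σ i)))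
        rw [hA1, hb1, hσ i] at h
        simp only [Bool.false_eq_true, if_false, add_zero] at h
        linarith
      have hsumσ : ∑ i, Y (R (σ i)) (R (σ i)) = ∑ j, Y (R j) (R j) :=
        Equiv.sum_comp σ (fun j => Y (R j) (R j))
      have hge : (n : ℝ) ≤ Y.trace := by
        rw [htrace, ← hsumσ, ← Finset.sum_add_distrib]
        calc (n : ℝ) = ∑ _i : Fin n, (1 : ℝ) := by simp
          _ ≤ ∑ i, (Y (L i) (L i) + Y (R (σ i)) (R (σ i))) := Finset.sum_le_sum fun i _ => he i
      linarith

/-- **One CONV gate suffices for the dual of bipartite perfect matching**: a size-one circuit over the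
CONV gates of width `n² + 2n + 1` computes `[K_{n,n} − v has no perfect matching]` on the edge set
`Fin n × Fin n` (`v` = the REMOVED edges). [folklore] -/
theorem exists_oneConvGate_dualBpm :
    ∃ C : Circuit (Fin n × Fin n), C.IsOver {g | IsConvGate (n * n + 2 * n + 1) g} ∧ C.size ≤ 1 ∧
      C.Computes (fun v => decide (¬ ∃ σ : Equiv.Perm (Fin n), ∀ i, v (i, σ i) = false)) := by
  classical
  obtain ⟨C, hC, hs, he⟩ := (CktSize.gate (B := {g | IsConvGate (n * n + 2 * n + 1) g})
    _ (dualBpm_isConvGate n) (fun a => finProdFinEquiv.symm a)).toCircuit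
  refine ⟨C, hC, hs, fun x => ?_⟩
  rw [he x]
  show decide (∀ σ : Equiv.Perm (Fin n), ∃ i,
      x (finProdFinEquiv.symm (finProdFinEquiv (i, σ i))) = true) = _
  simp only [Equiv.symm_apply_apply]
  congr 1
  simp only [not_exists, not_forall, Bool.not_eq_false]

/-- **Duality-audit cell D1 (registered sub-goal `dualBpm_oneConvGate`)**: for every `n` and every
`s ≥ n² + 2n + 1` a size-one `B_s`-circuit (one CONV gate) computes the dual of bipartite perfect
matching, `[K_{n,n} − v has no perfect matching]`, on the edge set `Fin n × Fin n` (`v` = the REMOVED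
edges). [folklore] -/
theorem dualBpm_oneConvGate : ∀ (n s : ℕ), n * n + 2 * n + 1 ≤ s →
    ∃ C : Circuit (Fin n × Fin n), C.IsOver (extGate s) ∧ C.size ≤ 1 ∧
      C.Computes (fun v => decide (¬ ∃ σ : Equiv.Perm (Fin n), ∀ i, v (i, σ i) = false)) := by
  intro n s hs
  obtain ⟨C, hC, h1, hc⟩ := exists_oneConvGate_dualBpm n
  exact ⟨C, hC.mono fun g hg => (IsConvGate.mono hg hs).mem_extGate, h1, hc⟩

end

end Summit.PneNP.PneNP.Theorems.Capture.DualityAudit
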